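import Summits.BirchSwinnertonDyer.BirchSwinnertonDyer.Theses.KatoDescentTamePotSupersingular
import Summits.BirchSwinnertonDyer.BirchSwinnertonDyer.Theorems.KatoDescentTamePotSupersingularTameUpperOptimalSharpNodesJ08
import HarnessLib

/-!
# Route `KatoDescentTamePotSupersingular` (rung K8, sub-rung B4 (t′), cell `bsd-potss`): CLOSER of the glue item
# `TameUpperNonsurjTowerOfOptimalSharpRoadJ08` (R146 — the U₀-ns node re-threaded through the LANDED Literature reading
# `Jetchev2008.cor15_irreducibleReading_…` BY NAME, alias item `JetchevIrreducibleReadingByName`) — one line over this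
# seat's kernel `TameUpperOptimalSharpNodesJ08.upperNonsurjTower_of_jetchev08_of_cruxAResidue`; seat `bsd-potss-k8t-c4` g7.
# Glue only: the alias crux (the reading, OPEN as a crux) and `TameCoatesSujathaResidue` stay open; BSD is not proved.
-/

set_option autoImplicit false
-- the Theorems directory repeats the summit name (sibling precedent `KatoDescentPotSupersingularAssembly.lean`)
set_option linter.dupNamespace false

noncomputable section

namespace Summit.BirchSwinnertonDyer.BirchSwinnertonDyer.Theorems

open Summit.BirchSwinnertonDyer.BirchSwinnertonDyer.Theses.KatoDescentTamePotSupersingular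

/-- **Closer of the glue item `TameUpperNonsurjTowerOfOptimalSharpRoadJ08`** (type = the route decl BY NAME): the alias
`JetchevIrreducibleReadingByName` unfolds to the Literature fact, the held Heegner conjunction is destructured, and this
seat's node `TameUpperOptimalSharpNodesJ08.upperNonsurjTower_of_jetchev08_of_cruxAResidue` applies. Glue only;
nothing about BSD is asserted. [cite: Jetchev2008, Thm. 1.4, Cor. 1.5 (p. 3), Rem. 6.2 (p. 15)]
[cite: MatarNekovar2019, Thm. 0.7, §0.11 (p. 457)] [cite: MilneADT2006, Thm. I.7.3] -/
theorem tameUpperNonsurjTowerOfOptimalSharpRoadJ08_proof :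
    Summit.BirchSwinnertonDyer.BirchSwinnertonDyer.Theses.KatoDescentTamePotSupersingular.TameUpperNonsurjTowerOfOptimalSharpRoadJ08 :=
  fun hJ hH hC₄ hCS a81 a84 a91 a87 =>
    TameUpperOptimalSharpNodesJ08.upperNonsurjTower_of_jetchev08_of_cruxAResidue
      hJ hH.1 hH.2.1 hH.2.2.1 hH.2.2.2.1 hH.2.2.2.2 hC₄ hCS a81 a84 a91 a87

end Summit.BirchSwinnertonDyer.BirchSwinnertonDyer.Theorems

end
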